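import Literature.Probability.LatticeModels.LocalizedSwitching
import Literature.Probability.LatticeModels.CurrentsSetConditioning
import HarnessLib

/-!
# The split event `G(u)` holds when no cluster crosses the two buffer annuli (Aizenman–Duminil-Copin 2021, proof of Lemma 6.7, first step)

Topic `Literature/Probability/LatticeModels`. The event `G(u)` of the localized switching
(`Current.SplitEvent`, `LocalizedSwitching.lean`; Aizenman–Duminil-Copin 2021, arXiv:1912.07973, §4.2
p. 13 and §6.2 p. 24) is bounded from below through the following deterministic observation (ibid.,
proof of **Lemma 6.7**, p. 25, and already in §4.2, p. 14):

  "Let `G_i` be the event that the current `𝐤_i` exists. This event clearly contains … the event that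
  `Ann(M,N)` is not crossed by a cluster in `n_i`, and `Ann(n,m)` is not crossed by a cluster in `n'_i`,
  since in such case `𝐤_i` can be defined as the sum of `n_i` restricted to the clusters intersecting
  `Λ_N^c` (this current has no sources) and `n_i'` restricted to the clusters intersecting `Λ_m^c`
  (this current has sources `u_i` and `y_i`)."

This file proves exactly that, for currents on a finite simple graph with four nested vertex sets
`P₁ ⊆ P₂ ⊆ P₃ ⊆ P₄` in the rôles of `Λ_n ⊆ Λ_m ⊆ Λ_M ⊆ Λ_N` (no metric is needed):

* `Current.splitEvent_of_noCrossing` — if no cluster of `n` meets both `P₄ᶜ` and `P₃`, no cluster of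
  `n'` meets both `P₂ᶜ` and `P₁`, `∂n = {x} Δ {u}` with `x, u ∈ P₃`, and `∂n' = {u} Δ {y}` with
  `y ∉ P₄`, then `SplitEvent E_in E_out u y (n + n')` holds with `E_in` the edges inside `P₁` and
  `E_out` the edges meeting `P₄ᶜ`: the witness is
  `k = n|_{C_n(P₄ᶜ)} + n'|_{C_{n'}(P₂ᶜ)}` (`Current.restrictTo`, `Current.clusterSet`), and the four
  printed properties (`k ≤ n + n'`, `k = 0` inside, `k = n + n'` outside, `∂k = {u,y}`) are
  `Current.splitWitness_le`, `…_eq_zero_of_inside`, `…_eq_add_of_outside`, `Current.sources_splitWitness`.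

Consequently the complement of `G(u)` is contained in the union of the two crossing events, whose
probabilities the chain rule for backbones and the sourceless crossing bound control
(`BackboneChainRule.lean`, `SourcelessConnectivity.lean`). No named fact is introduced; everything is
proved.

## References

* M. Aizenman, H. Duminil-Copin, Ann. of Math. 194 (2021), arXiv:1912.07973, §6.2, proof of Lemma 6.7
  (first paragraph, p. 25); §4.2, proof of Prop. 4.6 ("The event `G(y)` clearly contains …", p. 14)
  [AizenmanDuminilCopinAnnals2021].
-/

noncomputable section

open Finset
open scoped symmDiff

namespace Literature.Probability.LatticeModels

variable {V : Type*} [Fintype V] [DecidableEq V] {G : SimpleGraph V} [DecidableRel G.Adj]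

namespace Current

/-! ### The witness `k = n|_{C_n(P₄ᶜ)} + n'|_{C_{n'}(P₂ᶜ)}` -/

/-- **The witness of `G(u)`** (Aizenman–Duminil-Copin 2021, proof of Lemma 6.7: "`𝐤_i` can be defined as
the sum of `n_i` restricted to the clusters intersecting `Λ_N^c` … and `n_i'` restricted to the clusters
intersecting `Λ_m^c`"): `n|_{C_n(P₄ᶜ)} + n'|_{C_{n'}(P₂ᶜ)}`. [cite: AizenmanDuminilCopinAnnals2021, arXiv:1912.07973 §6.2, proof of Lemma 6.7 (p. 25)] -/
def splitWitness (P₂ P₄ : Finset V) (n n' : Current G) : Current G :=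
  restrictTo (n.clusterSet P₄ᶜ) n + restrictTo (n'.clusterSet P₂ᶜ) n'

/-- `k ≤ n + n'`. [cite: AizenmanDuminilCopinAnnals2021, arXiv:1912.07973 §6.2, proof of Lemma 6.7 (p. 25)] -/
theorem splitWitness_le (P₂ P₄ : Finset V) (n n' : Current G) : splitWitness P₂ P₄ n n' ≤ n + n' :=
  add_le_add (restrictTo_le _ _) (restrictTo_le _ _)

/-- **No crossing keeps the outer clusters away**: if no cluster of `n` meets both `Qᶜ… `— precisely, if
for every `s ∈ Q` the cluster `C_n(s)` misses `P`, then `C_n(Q) ∩ P = ∅`. [folklore] -/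
theorem clusterSet_disjoint_of_noCrossing {n : Current G} {Q P : Finset V}
    (h : ∀ s ∈ Q, ∀ v ∈ P, v ∉ n.cluster s) : Disjoint (n.clusterSet Q) P := by
  rw [Finset.disjoint_left]
  intro v hv hvP
  obtain ⟨s, hs, hvs⟩ := mem_clusterSet_iff.1 hv
  exact h s hs v hvP hvs

/-- A restriction vanishes on an edge having an endpoint outside the set. [folklore] -/
theorem restrictTo_apply_eq_zero_of_exists {W : Finset V} (n : Current G) {e : G.edgeFinset} {v : V}
    (hv : v ∈ (e : Sym2 V)) (hvW : v ∉ W) : restrictTo W n e = 0 :=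
  restrictTo_apply_of_not n fun h => hvW (h v hv)

/-- The restriction to `C_n(Q)` agrees with `n` on every edge meeting `Q` (a bond carrying current from a
vertex of `C_n(Q)` lies inside `C_n(Q)`). [folklore] -/
theorem restrictTo_clusterSet_apply_of_mem {n : Current G} {Q : Finset V} {e : G.edgeFinset} {v : V}
    (hv : v ∈ (e : Sym2 V)) (hvQ : v ∈ Q) : restrictTo (n.clusterSet Q) n e = n e := by
  rcases Nat.eq_zero_or_pos (n e) with h0 | hpos
  · rw [h0]
    unfold restrictTo
    split_ifs <;> simp [h0]
  · exact restrictTo_apply_of_forall_mem n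
      (forall_mem_clusterSet_of_pos hpos hv (subset_clusterSet n Q hvQ))

/-- **`k = 0` inside `P₁`** ("`𝐤 = 0` on `Λ_n`"): if `P₁ ⊆ P₃`, `C_n(P₄ᶜ)` misses `P₃` and `C_{n'}(P₂ᶜ)`
misses `P₁`, then `k` vanishes on every edge with an endpoint in `P₁`. [cite: AizenmanDuminilCopinAnnals2021, arXiv:1912.07973 §6.2, proof of Lemma 6.7 (p. 25)] -/
theorem splitWitness_eq_zero_of_inside {P₁ P₂ P₃ P₄ : Finset V} (h13 : P₁ ⊆ P₃) {n n' : Current G}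
    (hn : Disjoint (n.clusterSet P₄ᶜ) P₃) (hn' : Disjoint (n'.clusterSet P₂ᶜ) P₁)
    {e : G.edgeFinset} {v : V} (hv : v ∈ (e : Sym2 V)) (hvP : v ∈ P₁) : splitWitness P₂ P₄ n n' e = 0 := by
  unfold splitWitness
  rw [Pi.add_apply, restrictTo_apply_eq_zero_of_exists n hv (fun h => Finset.disjoint_left.1 hn h (h13 hvP)),
    restrictTo_apply_eq_zero_of_exists n' hv (fun h => Finset.disjoint_left.1 hn' h hvP), add_zero]

/-- **`k = n + n'` outside `P₄`** ("`𝐤 = n_i + n'_i` outside `Λ_N`"): if `P₂ ⊆ P₄`, then `k` agrees with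
`n + n'` on every edge with an endpoint outside `P₄`. [cite: AizenmanDuminilCopinAnnals2021, arXiv:1912.07973 §6.2, proof of Lemma 6.7 (p. 25)] -/
theorem splitWitness_eq_add_of_outside {P₂ P₄ : Finset V} (h24 : P₂ ⊆ P₄) (n n' : Current G)
    {e : G.edgeFinset} {v : V} (hv : v ∈ (e : Sym2 V)) (hvP : v ∉ P₄) :
    splitWitness P₂ P₄ n n' e = (n + n') e := by
  unfold splitWitness
  rw [Pi.add_apply, Pi.add_apply, restrictTo_clusterSet_apply_of_mem hv (mem_compl.2 hvP),
    restrictTo_clusterSet_apply_of_mem hv (mem_compl.2 fun h => hvP (h24 h))]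

/-- Sources of the restriction to the clusters of a set: `∂(n|_{C_n(W)}) = ∂n ∩ C_n(W)`. [folklore] -/
theorem sources_restrictTo_clusterSet (n : Current G) (W : Finset V) :
    (restrictTo (n.clusterSet W) n).sources = n.sources ∩ n.clusterSet W := by
  have hdec := eq_restrictTo_add_restrictTo_compl_set (le_refl n) W
  have h := (sources_add_eq_iff_of_isSupp (isSupp_restrictTo (n.clusterSet W) n)
    (isSupp_offGraph_restrictTo_compl (n.clusterSet W) n) n.sources).1 (by rw [← hdec])
  exact h.1

/-- **`∂k = {u} Δ {y}`** ("this current has no sources … this current has sources `u_i` and `y_i`"): with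
`∂n = {x} Δ {u}`, `x, u ∈ P₃`, `C_n(P₄ᶜ) ∩ P₃ = ∅`, and `∂n' = {u} Δ {y}`, `y ∉ P₂`, the witness has
sources `{u} Δ {y}`. [cite: AizenmanDuminilCopinAnnals2021, arXiv:1912.07973 §6.2, proof of Lemma 6.7 (p. 25)] -/
theorem sources_splitWitness {P₂ P₃ P₄ : Finset V} {n n' : Current G} {x u y : V}
    (hn : Disjoint (n.clusterSet P₄ᶜ) P₃) (hx : x ∈ P₃) (hu : u ∈ P₃) (hy : y ∉ P₂)
    (hns : n.sources = {x} ∆ {u}) (hn's : n'.sources = {u} ∆ {y}) :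
    (splitWitness P₂ P₄ n n').sources = {u} ∆ {y} := by
  unfold splitWitness
  rw [Current.sources_add, sources_restrictTo_clusterSet, sources_restrictTo_clusterSet, hns, hn's]
  -- the `n`-part has no sources
  have h1 : (({x} : Finset V) ∆ {u}) ∩ n.clusterSet P₄ᶜ = ∅ := by
    refine Finset.eq_empty_of_forall_notMem fun v hv => ?_
    rw [mem_inter] at hv
    rcases eq_or_eq_of_mem_symmDiff_singleton hv.1 with rfl | rfl
    · exact Finset.disjoint_left.1 hn hv.2 hx
    · exact Finset.disjoint_left.1 hn hv.2 hu
  -- the `n'`-part keeps both sources: `y ∈ P₂ᶜ ⊆ C_{n'}(P₂ᶜ)` and `u ↔ y` in `n'`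
  have hyC : y ∈ n'.clusterSet P₂ᶜ := subset_clusterSet n' _ (mem_compl.2 hy)
  have huC : u ∈ n'.clusterSet P₂ᶜ := by
    refine cluster_subset_clusterSet n' (mem_compl.2 hy) ?_
    rw [symmDiff_comm] at hn's
    exact mem_cluster_of_sources_eq hn's
  have h2 : (({u} : Finset V) ∆ {y}) ∩ n'.clusterSet P₂ᶜ = {u} ∆ {y} := by
    refine Finset.inter_eq_left.2 fun v hv => ?_
    rcases eq_or_eq_of_mem_symmDiff_singleton hv with rfl | rfl
    exacts [huC, hyC]
  rw [h1, h2, empty_symmDiff]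

/-- **The split event from the absence of crossings** (Aizenman–Duminil-Copin 2021, proof of Lemma 6.7:
"`G_i` … clearly contains the event that `Ann(M,N)` is not crossed by a cluster in `n_i`, and `Ann(n,m)`
is not crossed by a cluster in `n'_i`"): for nested vertex sets `P₁ ⊆ P₂ ⊆ P₃ ⊆ P₄` (`Λ_n ⊆ Λ_m ⊆ Λ_M ⊆ Λ_N`),
if no cluster of `n` meets both `P₄ᶜ` and `P₃`, no cluster of `n'` meets both `P₂ᶜ` and `P₁`,
`∂n = {x} Δ {u}` with `x, u ∈ P₃`, `∂n' = {u} Δ {y}` with `y ∉ P₄`, then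
`SplitEvent E_in E_out u y (n + n')` with `E_in` the edges inside `P₁` and `E_out` the edges meeting `P₄ᶜ`.
[cite: AizenmanDuminilCopinAnnals2021, arXiv:1912.07973 §6.2, proof of Lemma 6.7, first paragraph (p. 25)] -/
theorem splitEvent_of_noCrossing {P₁ P₂ P₃ P₄ : Finset V} (h12 : P₁ ⊆ P₂) (h23 : P₂ ⊆ P₃) (h34 : P₃ ⊆ P₄)
    {n n' : Current G} {x u y : V}
    (hn : ∀ s, s ∉ P₄ → ∀ v ∈ P₃, v ∉ n.cluster s) (hn' : ∀ s, s ∉ P₂ → ∀ v ∈ P₁, v ∉ n'.cluster s)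
    (hx : x ∈ P₃) (hu : u ∈ P₃) (hy : y ∉ P₄) (hns : n.sources = {x} ∆ {u}) (hn's : n'.sources = {u} ∆ {y})
    {Ein Eout : Finset G.edgeFinset} (hEin : ∀ e ∈ Ein, ∀ v ∈ (e : Sym2 V), v ∈ P₁)
    (hEout : ∀ e ∈ Eout, ∃ v ∈ (e : Sym2 V), v ∉ P₄) :
    SplitEvent Ein Eout u y (n + n') := by
  have hdn : Disjoint (n.clusterSet P₄ᶜ) P₃ :=
    clusterSet_disjoint_of_noCrossing fun s hs v hv => hn s (mem_compl.1 hs) v hv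
  have hdn' : Disjoint (n'.clusterSet P₂ᶜ) P₁ :=
    clusterSet_disjoint_of_noCrossing fun s hs v hv => hn' s (mem_compl.1 hs) v hv
  refine ⟨splitWitness P₂ P₄ n n', splitWitness_le P₂ P₄ n n', fun e he => ?_, fun e he => ?_,
    sources_splitWitness hdn hx hu (fun h => hy (h34 (h23 h))) hns hn's⟩
  · -- an edge of `E_in` has an endpoint (in fact all) in `P₁`
    obtain ⟨v, hv⟩ : ∃ v, v ∈ (e : Sym2 V) := by
      obtain ⟨e', he'⟩ := e
      induction e' using Sym2.ind with
      | _ a b => exact ⟨a, Sym2.mem_mk_left a b⟩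
    exact splitWitness_eq_zero_of_inside (h12.trans h23) hdn hdn' hv (hEin e he v hv)
  · obtain ⟨v, hv, hvP⟩ := hEout e he
    exact splitWitness_eq_add_of_outside (h23.trans h34) n n' hv hvP

end Current

end Literature.Probability.LatticeModels
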